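import Summits.AtomisticToContinuum.Crystallization.Theses.GappedShellCensus

/-!
# `FiveFoldRationingR` (stmt-AtomisticToContinuum-18071), negative side: hypothesis bookkeeping

Two cheap facts about the hypothesis list of the crux `GappedShellCensus.FiveFoldRationingR`
(`∀ Y a, 0 < a → Y.Nonempty → Gapped → TornFree → ∀ R, ∃ c ∈ Y, …`):

* `Y.Nonempty` is LOAD-BEARING (`fiveFoldRationingR_false_without_nonempty`): with it deleted the
  statement is false — for `Y = ∅` both configuration hypotheses hold vacuously and the conclusion asks
  for a centre `c ∈ Y`.  (It is used exactly once in every proof line on the item: to centre the clean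
  ball.)
* `0 < a` is DECORATION (`scale_pos_of_gappedTwelve`): it follows from `Y.Nonempty` and the
  gapped-twelve hypothesis alone (a site has twelve OTHER points within `a(1 + 1/50)`, impossible for
  `a ≤ 0`), so dropping it changes nothing.

Negative-side support for the crux (no route item is concluded positively); refuter seat
refuter-cdisprove-stmt-AtomisticToContinuum-18071-0, 2026-08-17.  The substantive hypothesis analysis
(the one-shell-deep local form is false: decahedral-rod fragment) is `Negative/OneShell.lean`.
-/

namespace Summit.AtomisticToContinuum.Crystallization.Theorems.FiveFoldRationingR.Negative

/-- `FiveFoldRationingR` with the hypothesis `Y.Nonempty` deleted (everything else verbatim).  A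
weakened crux for hypothesis analysis (Negative/ lane), not a literature fact. -/
def FiveFoldRationingRWithoutNonempty : Prop :=
  ∀ (Y : Set (EuclideanSpace ℝ (Fin 3))) (a : ℝ), 0 < a →
    (∀ y ∈ Y, ({w ∈ Y | w ≠ y ∧ dist y w ≤ a * (1 + 1 / 50)}.ncard = 12 ∧
      ∀ w ∈ Y, w ≠ y → a * (1 - 1 / 50) ≤ dist y w ∧
        (dist y w ≤ a * (1 + 1 / 50) ∨ a * (63 / 50) ≤ dist y w))) →
    (∀ y ∈ Y, ∀ v ∈ Y, v ≠ y → dist y v ≤ a * (1 + 1 / 50) →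
      4 ≤ {w ∈ Y | w ≠ y ∧ w ≠ v ∧ dist y w ≤ a * (1 + 1 / 50) ∧ dist v w ≤ a * (1 + 1 / 50)}.ncard) →
    ∀ R : ℝ, ∃ c ∈ Y, ∀ y ∈ Y, dist y c ≤ R → ∀ v ∈ Y, v ≠ y → dist y v ≤ a * (1 + 1 / 50) →
      {w ∈ Y | w ≠ y ∧ w ≠ v ∧ dist y w ≤ a * (1 + 1 / 50) ∧ dist v w ≤ a * (1 + 1 / 50)}.ncard ≤ 4

/-- **`Y.Nonempty` is load-bearing**: without it `FiveFoldRationingR` fails at `Y = ∅`, `a = 1`,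
`R = 0` (hypotheses vacuous, no centre `c ∈ ∅`). [folklore] -/
theorem fiveFoldRationingR_false_without_nonempty : ¬ FiveFoldRationingRWithoutNonempty := by
  intro h
  obtain ⟨c, hc, -⟩ := h ∅ 1 one_pos (by simp) (by simp) 0
  exact hc

/-- **`0 < a` is decoration**: a nonempty configuration in which some site has exactly twelve other
points within `a(1 + 1/50)` has `0 < a`. [folklore] -/
theorem scale_pos_of_gappedTwelve {Y : Set (EuclideanSpace ℝ (Fin 3))} {a : ℝ} (hY : Y.Nonempty)
    (hG : ∀ y ∈ Y, ({w ∈ Y | w ≠ y ∧ dist y w ≤ a * (1 + 1 / 50)}.ncard = 12 ∧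
      ∀ w ∈ Y, w ≠ y → a * (1 - 1 / 50) ≤ dist y w ∧
        (dist y w ≤ a * (1 + 1 / 50) ∨ a * (63 / 50) ≤ dist y w))) :
    0 < a := by
  obtain ⟨y, hy⟩ := hY
  obtain ⟨h12, -⟩ := hG y hy
  by_contra ha
  push Not at ha
  have hempty : {w ∈ Y | w ≠ y ∧ dist y w ≤ a * (1 + 1 / 50)} = ∅ := by
    ext w
    simp only [Set.mem_setOf_eq, Set.mem_empty_iff_false, iff_false, not_and]
    intro _ hne hd
    have h0 : dist y w ≤ 0 := hd.trans (by nlinarith)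
    exact hne (dist_le_zero.1 h0).symm
  rw [hempty, Set.ncard_empty] at h12
  exact absurd h12 (by norm_num)

end Summit.AtomisticToContinuum.Crystallization.Theorems.FiveFoldRationingR.Negative
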